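import Literature.MathematicalPhysics.QuantumFieldTheory.O2ThreeScalarSystem
import Literature.MathematicalPhysics.QuantumFieldTheory.OPESpaceCoverCertificate
import HarnessLib

/-!
# The OPE scan of the `O(2)` system: from a finite list of functionals to an excluded box
# (Chester et al. 2020, §3.3)

The glue between the typed `O(2)` `{s, φ, t}` axioms (`O2ThreeScalarSystem`: `BoxExcluded`,
`IsPositiveFor`, `boxExcluded_of_pointFunctionals`) and the OPE-space exhaustion certificates
(`OPESpaceCoverCertificate`: `Exhausted`, `RobustlyExhausted`, `CoverTree`), i.e. the sentence of
Chester–Landry–Liu–Poland–Simmons-Duffin–Su–Vichi, *Carving out OPE space and precise O(2) model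
critical exponents*, JHEP 06 (2020) 142 [arXiv:1912.03324], §3.3: *"we should scan over directions in
OPE coefficient space `[λ_ext] ∈ ℝℙ³`.  For each direction, we should compute whether a functional `α`
exists satisfying [the weaker condition `λ_extᵀ α(V⃗_ext) λ_ext ≥ 0`] and [all other positivity
conditions].  … If `α` exists for all `[λ_ext]`, then the point `(Δ_s, Δ_φ, Δ_t)` is disallowed"*,
organised as in their Algorithm 1: *"Given a list of functionals `{α₁,…,α_n}`, together with quadratic
forms `Q_i = α_i(V⃗_ext)` … [if] `𝒜_n` is empty [then] all directions in OPE space are ruled out."*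

RENDERING.  `boxExcluded_of_pointFunctionals` asks, at every point `D` of the box and for every class
representative `l ≠ 0`, for SOME point functional with `IsPositiveFor _ A D l`.  That predicate is the
conjunction of an `l`-INDEPENDENT part — the unit normalisation and the seven families of sector
positivity conditions, which is `IsPositiveFor _ A D 0` (at `l = 0` the external condition is
`0 ≤ 0`; this is how `boxExcluded_of_pointFunctionals_strong` already uses it) — and the external
condition `ExtNonnegAt α D l`: `lᵀ α(V⃗_ext) l ≥ 0` for EVERY genuine choice of the external block
families.  A FINITE LIST of functionals `F k` (`k : ι`, point functionals packaged as
`ScanFunctional`), each satisfying the `l`-independent part, serves every class as soon as every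
`l ≠ 0` has some `k` with `ExtNonnegAt (F k) D l` (`exists_pointFunctional_of_scan`,
`boxExcluded_of_scan`) — Algorithm 1's termination.  Because the external forms
`Q_k = α_k(V⃗_ext)` depend on the genuine external blocks (real numbers a verifier only encloses),
the certificate format that applies is the ROBUST one: entrywise enclosures `Blo k ≤ Q_k ≤ Bhi k`
valid for all genuine families (`ExtEnclosed`) and `RobustlyExhausted Blo Bhi`
(`scan_of_robustlyExhausted`), in particular one certified box-tree per facet of the cube in `ℝ⁴`
(`boxExcluded_of_coverTrees`; uniform-in-`D` version `boxExcluded_of_uniformCoverTrees`, the shape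
a verifier emits for a small box of external dimensions: ONE functional list, ONE set of enclosures
valid on the whole box, FOUR trees).

HONEST LIMITS.  Nothing here produces functionals, enclosures or trees; the (S) multiplier format of
`OPESpaceCoverCertificate` is not bridged (it certifies exhaustion of ONE family of forms, whereas
the index `k` must serve all genuine external families at once — the robust format does exactly
that).  No number of the paper is used.

## References

* S. M. Chester, W. Landry, J. Liu, D. Poland, D. Simmons-Duffin, N. Su, A. Vichi, *Carving out OPE
  space and precise O(2) model critical exponents*, JHEP 06 (2020) 142, §3.2–§3.3. [ChesterEtAl2020]
-/

noncomputable section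

open Set Matrix

namespace Literature.MathematicalPhysics.QuantumFieldTheory.O2OPEScanBridge

open O2ThreeScalarCrossing O2ThreeScalarSystem OPESpaceCoverCertificate

/-! ## Point functionals as data -/

/-- A point functional of the scan: `M` evaluation points `(z_m, z̄_m) ∈ (0,1)²` and weights
`w_m ∈ ℝ²²` (the functional is `F ↦ Σ_m Σ_r w_{m r} F_r(z_m z̄_m, (1−z_m)(1−z̄_m))`)
[cite: ChesterEtAl2020, §3.3 (Algorithm 1: "a list of functionals `{α₁,…,α_n}`")]. -/
structure ScanFunctional where
  /-- number of evaluation points -/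
  M : ℕ
  /-- weights, one 22-vector per point -/
  w : Fin M → Fin 22 → ℝ
  /-- the points `z_m` -/
  z : Fin M → ℝ
  /-- the points `z̄_m` -/
  zb : Fin M → ℝ
  /-- `z_m ∈ (0, 1)` -/
  hz : ∀ m, z m ∈ Ioo (0 : ℝ) 1
  /-- `z̄_m ∈ (0, 1)` -/
  hzb : ∀ m, zb m ∈ Ioo (0 : ℝ) 1

namespace ScanFunctional

/-- The cross-ratio `u_m = z_m z̄_m` [cite: ChesterEtAl2020, §3.1 (functionals act at points of the
`z, z̄` plane)]. -/
def u (F : ScanFunctional) : Fin F.M → ℝ := fun m => F.z m * F.zb m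

/-- The cross-ratio `v_m = (1 − z_m)(1 − z̄_m)` [cite: ChesterEtAl2020, §3.1]. -/
def v (F : ScanFunctional) : Fin F.M → ℝ := fun m => (1 - F.z m) * (1 - F.zb m)

/-- The linear functional on `22`-vector-valued functions of `(u, v)`
[cite: ChesterEtAl2020, §3.1 (functional conditions)]. -/
def toFunctional (F : ScanFunctional) : (ℝ → ℝ → Fin 22 → ℝ) →ₗ[ℝ] ℝ :=
  pointFunctional₂₂ F.w F.u F.v

end ScanFunctional

/-! ## The split of `IsPositiveFor` into its `l`-independent part and the external condition -/

/-- The external ("weaker") condition at class `l`: `lᵀ α(V⃗_ext) l ≥ 0` for every genuine choice of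
the external block families [cite: ChesterEtAl2020, §3.2 (weaker condition), §3.3]. -/
def ExtNonnegAt (α : (ℝ → ℝ → Fin 22 → ℝ) →ₗ[ℝ] ℝ) (D : Dims) (l : Fin 4 → ℝ) : Prop :=
  ∀ gs gφ gt : Label → ℝ → ℝ → ℝ, GenuineOn D labels0p D.Δs 0 gs → GenuineOn D labels1 D.Δφ 0 gφ →
    GenuineOn D labels2p D.Δt 0 gt → 0 ≤ l ⬝ᵥ (alphaMat α (Vext D gs gφ gt) *ᵥ l)

/-- `IsPositiveFor α A D l` from its `l`-independent part `IsPositiveFor α A D 0` (normalisation and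
the seven sector families) and the external condition at `l`
[cite: ChesterEtAl2020, §3.1 (functional conditions), §3.2 (weaker condition)]. -/
theorem isPositiveFor_of_zero_of_ext {α : (ℝ → ℝ → Fin 22 → ℝ) →ₗ[ℝ] ℝ} {A : O2Gaps} {D : Dims}
    (h0 : IsPositiveFor α A D 0) {l : Fin 4 → ℝ} (hext : ExtNonnegAt α D l) : IsPositiveFor α A D l :=
  ⟨h0.1, hext, h0.2.2⟩

/-- Conversely the `l`-independent part is implied at any class
[cite: ChesterEtAl2020, §3.1 (functional conditions)]. -/
theorem isPositiveFor_zero_of {α : (ℝ → ℝ → Fin 22 → ℝ) →ₗ[ℝ] ℝ} {A : O2Gaps} {D : Dims}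
    {l : Fin 4 → ℝ} (h : IsPositiveFor α A D l) : IsPositiveFor α A D 0 :=
  ⟨h.1, fun gs gφ gt _ _ _ => by simp, h.2.2⟩

/-- … and so is the external condition [cite: ChesterEtAl2020, §3.2 (weaker condition)]. -/
theorem extNonnegAt_of {α : (ℝ → ℝ → Fin 22 → ℝ) →ₗ[ℝ] ℝ} {A : O2Gaps} {D : Dims}
    {l : Fin 4 → ℝ} (h : IsPositiveFor α A D l) : ExtNonnegAt α D l :=
  h.2.1

/-! ## Algorithm 1's termination: a finite list serving every class -/

/-- **A functional list exhausting OPE space yields the class-wise functionals.**  If every `F k`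
satisfies the `l`-independent conditions and every class `l ≠ 0` has some `k` with the external
condition, the hypothesis of `boxExcluded_of_pointFunctionals` holds at `D`
[cite: ChesterEtAl2020, §3.3 ("If `α` exists for all `[λ_ext]`, then the point is disallowed";
Algorithm 1)]. -/
theorem exists_pointFunctional_of_scan {A : O2Gaps} {D : Dims} {ι : Type*} (F : ι → ScanFunctional)
    (hcore : ∀ k, IsPositiveFor (F k).toFunctional A D 0)
    (hscan : ∀ l : Fin 4 → ℝ, l ≠ 0 → ∃ k, ExtNonnegAt (F k).toFunctional D l) :
    ∀ l : Fin 4 → ℝ, l ≠ 0 →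
      ∃ (M : ℕ) (w : Fin M → Fin 22 → ℝ) (z zb : Fin M → ℝ),
        (∀ m, z m ∈ Ioo (0 : ℝ) 1) ∧ (∀ m, zb m ∈ Ioo (0 : ℝ) 1) ∧
          IsPositiveFor (pointFunctional₂₂ w (fun m => z m * zb m) (fun m => (1 - z m) * (1 - zb m)))
            A D l := by
  intro l hl
  obtain ⟨k, hk⟩ := hscan l hl
  exact ⟨(F k).M, (F k).w, (F k).z, (F k).zb, (F k).hz, (F k).hzb,
    isPositiveFor_of_zero_of_ext (hcore k) hk⟩

/-- **Box exclusion from a scan at every point of the box** (functional lists may depend on `D`)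
[cite: ChesterEtAl2020, §3.3 (allowed and disallowed points; Algorithm 1)]. -/
theorem boxExcluded_of_scan {A : O2Gaps} {Q : Set (ℝ × ℝ × ℝ)} (ι : Dims → Type*)
    (F : ∀ D, ι D → ScanFunctional)
    (hcore : ∀ D : Dims, (D.Δs, D.Δφ, D.Δt) ∈ Q → ∀ k, IsPositiveFor (F D k).toFunctional A D 0)
    (hscan : ∀ D : Dims, (D.Δs, D.Δφ, D.Δt) ∈ Q →
      ∀ l : Fin 4 → ℝ, l ≠ 0 → ∃ k, ExtNonnegAt (F D k).toFunctional D l) :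
    BoxExcluded A Q :=
  boxExcluded_of_pointFunctionals fun D hD =>
    exists_pointFunctional_of_scan (F D) (hcore D hD) (hscan D hD)

/-! ## The robust certificate: enclosed external forms and `RobustlyExhausted` -/

/-- Entrywise enclosure of the external form `α(V⃗_ext)` valid for EVERY genuine choice of the external
block families (what a verifier knows about the `4 × 4` matrix `Q = α(V⃗_ext)`)
[cite: ChesterEtAl2020, §3.3 (`Q_i = α_i(V⃗_ext)`)]. -/
def ExtEnclosed (α : (ℝ → ℝ → Fin 22 → ℝ) →ₗ[ℝ] ℝ) (D : Dims) (Blo Bhi : Matrix (Fin 4) (Fin 4) ℝ) :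
    Prop :=
  ∀ gs gφ gt : Label → ℝ → ℝ → ℝ, GenuineOn D labels0p D.Δs 0 gs → GenuineOn D labels1 D.Δφ 0 gφ →
    GenuineOn D labels2p D.Δt 0 gt → InBounds (alphaMat α (Vext D gs gφ gt)) Blo Bhi

/-- Robust exhaustion of the enclosures gives, for every class, an index serving all genuine external
families at once [cite: ChesterEtAl2020, §3.3 (Algorithm 1: `𝒜_n = ∅`)]. -/
theorem scan_of_robustlyExhausted {D : Dims} {ι : Type*} (α : ι → (ℝ → ℝ → Fin 22 → ℝ) →ₗ[ℝ] ℝ)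
    (Blo Bhi : ι → Matrix (Fin 4) (Fin 4) ℝ) (henc : ∀ k, ExtEnclosed (α k) D (Blo k) (Bhi k))
    (hR : RobustlyExhausted Blo Bhi) :
    ∀ l : Fin 4 → ℝ, l ≠ 0 → ∃ k, ExtNonnegAt (α k) D l := by
  intro l hl
  obtain ⟨k, hk⟩ := hR l hl
  exact ⟨k, fun gs gφ gt h1 h2 h3 => hk _ (henc k gs gφ gt h1 h2 h3)⟩

/-- **Box exclusion from certified box-trees** (data may depend on the point `D`): functionals with
the `l`-independent conditions, enclosures of their external forms, and for each of the four facets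
of the cube in `ℝ⁴` a box-tree certified for the interval vertex test
[cite: ChesterEtAl2020, §3.3 (Algorithm 1), §3.4 (a deterministic replacement of the QCQP step)]. -/
theorem boxExcluded_of_coverTrees {A : O2Gaps} {Q : Set (ℝ × ℝ × ℝ)} (ι : Dims → Type*)
    (F : ∀ D, ι D → ScanFunctional) (Blo Bhi : ∀ D, ι D → Matrix (Fin 4) (Fin 4) ℝ)
    (T : ∀ D, Fin 4 → CoverTree (ι D) 4)
    (hcore : ∀ D : Dims, (D.Δs, D.Δφ, D.Δt) ∈ Q → ∀ k, IsPositiveFor (F D k).toFunctional A D 0)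
    (henc : ∀ D : Dims, (D.Δs, D.Δφ, D.Δt) ∈ Q →
      ∀ k, ExtEnclosed (F D k).toFunctional D (Blo D k) (Bhi D k))
    (hT : ∀ D : Dims, (D.Δs, D.Δφ, D.Δt) ∈ Q → ∀ i : Fin 4,
      (T D i).Certifies (intervalVertexTest (Blo D) (Bhi D)) (facetLo i) (fun _ => (1 : ℝ))) :
    BoxExcluded A Q :=
  boxExcluded_of_scan ι F hcore fun D hD =>
    scan_of_robustlyExhausted (fun k => (F D k).toFunctional) (Blo D) (Bhi D) (henc D hD)
      (robustlyExhausted_of_coverTrees (Blo D) (Bhi D) (T D) (hT D hD))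

/-- **Uniform certificate for a box of external dimensions** — the shape a verifier emits: ONE
functional list, ONE family of enclosures valid at every point of `Q`, FOUR certified trees
[cite: ChesterEtAl2020, §3.3 (Algorithm 1), §3.4]. -/
theorem boxExcluded_of_uniformCoverTrees {A : O2Gaps} {Q : Set (ℝ × ℝ × ℝ)} {ι : Type*}
    (F : ι → ScanFunctional) (Blo Bhi : ι → Matrix (Fin 4) (Fin 4) ℝ) (T : Fin 4 → CoverTree ι 4)
    (hcore : ∀ D : Dims, (D.Δs, D.Δφ, D.Δt) ∈ Q → ∀ k, IsPositiveFor (F k).toFunctional A D 0)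
    (henc : ∀ D : Dims, (D.Δs, D.Δφ, D.Δt) ∈ Q → ∀ k, ExtEnclosed (F k).toFunctional D (Blo k) (Bhi k))
    (hT : ∀ i : Fin 4, (T i).Certifies (intervalVertexTest Blo Bhi) (facetLo i) (fun _ => (1 : ℝ))) :
    BoxExcluded A Q :=
  boxExcluded_of_coverTrees (fun _ => ι) (fun _ => F) (fun _ => Blo) (fun _ => Bhi) (fun _ => T) hcore
    henc fun _ _ => hT

/-- The robust certificate also delivers plain exhaustion of the actual external forms, for any
genuine external families (a consistency statement: the certified list does rule out all of
`ℝℙ³` in the sense of Algorithm 1) [cite: ChesterEtAl2020, §3.3 (Algorithm 1: `𝒜_n = ∅`)]. -/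
theorem exhausted_extForms {D : Dims} {ι : Type*} (α : ι → (ℝ → ℝ → Fin 22 → ℝ) →ₗ[ℝ] ℝ)
    (Blo Bhi : ι → Matrix (Fin 4) (Fin 4) ℝ) (henc : ∀ k, ExtEnclosed (α k) D (Blo k) (Bhi k))
    (hR : RobustlyExhausted Blo Bhi) {gs gφ gt : Label → ℝ → ℝ → ℝ}
    (h1 : GenuineOn D labels0p D.Δs 0 gs) (h2 : GenuineOn D labels1 D.Δφ 0 gφ)
    (h3 : GenuineOn D labels2p D.Δt 0 gt) :
    Exhausted fun k => alphaMat (α k) (Vext D gs gφ gt) :=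
  hR.exhausted fun k => henc k gs gφ gt h1 h2 h3

end Literature.MathematicalPhysics.QuantumFieldTheory.O2OPEScanBridge

end
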